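import Literature.Computability.AlgebraicComplexity.FSV18Thm9OccurOfTopFanIn
import Literature.Computability.AlgebraicComplexity.ASSS16DescentFaithful
import Literature.Computability.AlgebraicComplexity.ASSS16RecursionBound
import Literature.Computability.AlgebraicComplexity.ASSS16SparseLeafMinors
import Literature.Computability.AlgebraicComplexity.FSV18OccurModelViews
import Literature.Computability.AlgebraicComplexity.ASSS16LevelRecursion
import Literature.Computability.AlgebraicComplexity.ASSS16BaseLevel
import Literature.Computability.AlgebraicComplexity.FSV18OccurTopFamily
import HarnessLib

/-!
# FSV 2018 Thm. 48 on [ASSS16]'s reduced class — the named fact `FSV2018_thm48_topFanIn` DISCHARGED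
# ([ASSS16] §4, Thm. dDkrPIT: the level recursion, assembled)

Agrawal–Saha–Saptharishi–Saxena, *Jacobian hits circuits* [ASSS16] (arXiv:1111.0582; SIAM J. Comput.
45 (2016)), §4, proof of Theorem `thm:dDkrPIT` (locator: paper:arxiv-1111.0582 p0009.txt:L22–L34,
p0010.txt:L1–L62): for a depth-`D` occur-`k` formula `C = Σ_{i ≤ t} T_i` of size `s` (top fan-in `t`;
printed with `t = k` after the multiply-by-a-product reduction), the map
`Ψ : x_m ↦ Σ_{ℓ=2}^{D-1} Vdm_{r_ℓ}(y_ℓ, t_ℓ)_m + Φ(w)_m` — one Vandermonde block [ASSS16, (2)] of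
`r_ℓ` fresh seeds per level, `r_2 = t`, `r_{ℓ+1} = (c_ℓ+1)·2^{c_ℓ+1}·k·r_ℓ²`, `c_ℓ = ℓ - 2`, all
`r_ℓ ≤ R = (2·max(k,t))^{2D·2^D}`, on top of a generator `Φ` for the polynomials of sparsity
`≤ R!·s^R` — is faithful to `{T_1, …, T_t}`, hence (Thm. 2.1) `Ψ(C) ≠ 0` whenever `C ≠ 0`, provided
`char(𝔽) = 0` or `char(𝔽) > s^R`. Forbes–Shpilka–Volk [ForbesShpilkaVolk2018] Thm. 48 (= ToC Thm. 5.24)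
quote this construction; the tree states it, in generator form on the reduced class
`occurClassTopFanIn` (val-lit p1's F1, `FSV18OccurTopFanIn`), as the named fact
`FSV2018_thm48_topFanIn`, the ONE Literature fact the N1 row `FSV2018_thm9` was conditional on
(`FSV18Thm9OfTopFanIn`).

This file proves it (`FSV2018_thm48_topFanIn_holds`), following the printed proof step by step and
assembling the pieces landed by the val-lit N1 push:

* Part A — the degenerate parameter `k = 0` (an occur-`0` formula is a constant); the rest of the
  model bookkeeping is val-lit t19's `FSV18OccurTopFamily` / t21's `ASSS16BaseLevel`.
* Part B — `thm48_levelInvariant_step`: ONE LEVEL of the recursion in Thm. 2.1 ("faithful") form —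
  a transcendence basis of the level family has a non-zero Jacobian minor
  (p2's `ASSS16.exists_trdeg_jacobianMinor_ne_zero`, Fact 1); Lemma 4.2 factors it as
  `∏ V_G^{e_G} · V` with `Elem(V)` in the next level's family (t19's `ASSS16.descentJacobian`, count
  `level_count_le_asssStep`); the induction hypothesis keeps `V` and every `V_G` non-zero under the
  deeper map; Cor. 4.3 = Lemma 2.2 on a fresh Vandermonde block lifts faithfulness one level up
  (p2's `ASSS16.descentFaithful`).
* Part C — `FSV2018_thm48_topFanIn_of_clause`: the downward level induction `INV(D-3) ⇒ … ⇒ INV(0)`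
  over F1's seed layout `(Fin (D-2) × (Fin R ⊕ Unit)) ⊕ τ` (block `j` = level `j+2`, sizes
  `r_j = (asssRec k t j).1 ≤ R` by t21's `ASSS16RecursionBound`), base = the level of the sparse
  polynomials (t21's `ASSS16.baseLevel`: `Φ` hits the sparse Jacobian minors, budget `r_j!·s^{r_j} ≤
  R!·s^R`), top = the children of the root `+` gate (Thm. 2.1, p2's `map_aeval_ne_zero_of_faithful`);
  the characteristic clause is taken AS THE PROOF NEEDS IT (Jacobian criterion level by level:
  `char = 0 ∨ ((s+1)^{D-1-j})^{r_j} < char` for `j ≤ D-3`, degree bound `(s+1)^{depth}` of FSV's size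
  convention, p1's `OccurFormula.totalDegree_eval_le`).
* Part D — `thm48_clause_of_printed_clause`: the PRINTED clause `char = 0 ∨ s^R < char` implies the
  level-wise one for `s ≥ 2` (t21's `ASSS16.char_clause_of_level_sub_three`); for `s ≤ 1` the class
  consists of constants (p1's `isHittingSetGenerator_occurClass_of_le_one`); whence
  `FSV2018_thm48_topFanIn_holds : FSV2018_thm48_topFanIn`.

Theorem-only: no definitions, no named facts; net debt `−1` (`FSV2018_thm48_topFanIn`). With
`FSV2018_thm9_of_thm48_topFanIn` (`FSV18Thm9OfTopFanIn`) the N1 row `FSV2018_thm9` and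
`FSV2018_thm9_occur` follow unconditionally. Honest framing: a printed theorem of [ASSS16] (quoted by
FSV18) re-proved in the kernel on FSV's formula model; `VP ≠ VNP` is NOT proved and nothing here is
progress on it. bears_on: V4 (N1).

## References
* [AgrawalEtAl2011] M. Agrawal, C. Saha, R. Saptharishi, N. Saxena, *Jacobian hits circuits:
  hitting-sets, lower bounds for depth-D occur-k formulas & depth-3 transcendence degree-k circuits*,
  STOC 2012 / SIAM J. Comput. 45(4) (2016), arXiv:1111.0582 — §2 (Fact 1, Thm. 2.1, Lemma 2.2),
  §4 (Lemma 4.1, Lemma 4.2, Cor. 4.3, Thm. dDkrPIT), §7.3 (proof of Lemma 4.2). Locators: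
  paper:arxiv-1111.0582 p0006–p0007, p0009:L1–p0011:L32, p0018–p0019.
* [ForbesShpilkaVolk2018] M. A. Forbes, A. Shpilka, B. L. Volk, *Succinct hitting sets and barriers to
  proving lower bounds for algebraic circuits*, Theory of Computing 14(18) (2018), arXiv:1701.05328 —
  Def. 45 (seq.) = ToC Def. 5.21, Thm. 48 (seq.) = ToC Thm. 5.24, Cor. 49, Thm. 9.
-/

noncomputable section

namespace Literature.Computability.AlgebraicComplexity

open MvPolynomial Finset Literature.Barriers.ValiantsHypothesis
open Literature.RepresentationTheory.AlgebraicGroups (iterPderiv iterPderiv_zero)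

/-! ## Part A. Model bookkeeping (FSV Def. 45): an occur-`0` formula computes a constant (the
degenerate parameter `k = 0`); the rest of the bookkeeping is val-lit t19's `FSV18OccurTopFamily`
and t21's `ASSS16BaseLevel` -/

section Model

variable {F : Type*} [Field F] {ι : Type*}

/-- **An occur-`0` formula computes a constant** (no variable occurs in any leaf; the degenerate
parameter `k = 0` of [ASSS16]'s theorem). [cite: ForbesShpilkaVolk2018, Def. 45 (seq.) = ToC Def. 5.21; AgrawalEtAl2011, §4] -/
theorem OccurFormula.exists_eval_eq_C_of_occur_eq_zero [DecidableEq ι] (φ : OccurFormula F ι)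
    (h : ∀ i, φ.occur i = 0) : ∃ c : F, φ.eval = C c :=
  ⟨_, vars_eq_empty_iff_eq_C.1 (Finset.eq_empty_of_forall_notMem fun i =>
    OccurFormula.notMem_vars_eval_of_occur_eq_zero i φ (h i))⟩

end Model

/-! ## Part B. One level of [ASSS16]'s recursion (Lemma 4.2 + Cor. 4.3 + the Jacobian criterion),
in generic form: the next-level map `Ψ'` is faithful (Thm. 2.1 form) to every small family of
derivatives of sub-formulas of depth `≤ d - 1` ⟹ `block ⊕ Ψ'` is faithful to every small family of
derivatives of sub-formulas of depth `≤ d` -/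

section Step

variable {F : Type*} [Field F] {n : ℕ} {σ : Type*}

/-- Bookkeeping for Lemma 4.2's count: `k(ρc + ρ²) + ρ²(2^{c+1} - 1)k(c+1) ≤ (c+1)·2^{c+1}·k·r²`
for `ρ ≤ r` ("`r_{ℓ+1} := (c_ℓ+1)·2^{c_ℓ+1}·k·r_ℓ²`"). [cite: AgrawalEtAl2011, Lemma 4.2 (= lem:descent-jacobian)]
locator: paper:arxiv-1111.0582 p0019.txt:L1–L12 -/
theorem level_count_le_asssStep {k c ρ r : ℕ} (hρ : ρ ≤ r) :
    k * (ρ * c + ρ ^ 2) + ρ ^ 2 * (2 ^ (c + 1) - 1) * k * (c + 1) ≤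
      (c + 1) * 2 ^ (c + 1) * k * r ^ 2 := by
  obtain ⟨t2, ht2⟩ : ∃ t2, 2 ^ (c + 1) = t2 + 1 :=
    ⟨2 ^ (c + 1) - 1, (Nat.succ_pred_eq_of_pos (Nat.two_pow_pos _)).symm⟩
  have hsub : 2 ^ (c + 1) - 1 = t2 := by omega
  have hρsq : ρ ≤ ρ ^ 2 := Nat.le_self_pow two_ne_zero ρ
  have h1 : ρ * c + ρ ^ 2 ≤ (c + 1) * ρ ^ 2 := by nlinarith
  rw [hsub, ht2]
  calc k * (ρ * c + ρ ^ 2) + ρ ^ 2 * t2 * k * (c + 1)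
      ≤ k * ((c + 1) * ρ ^ 2) + ρ ^ 2 * t2 * k * (c + 1) := by gcongr
    _ = (c + 1) * (t2 + 1) * k * ρ ^ 2 := by ring
    _ ≤ (c + 1) * (t2 + 1) * k * r ^ 2 := by gcongr

/-- **One level of the recursion ([ASSS16] Lemma 4.2 + Cor. 4.3 with Fact 1 / Thm. 2.1), generic
form.** Data: resource bounds `k ≥ 1` (occurrences), `s` (size), `d ≥ 3` (depth of this level's
sub-formulas), `c` (order of this level's derivatives), `rj` (this level's family size = the seeds
of this level's Vandermonde block `emb`), `rj1 ≥ (c+1)2^{c+1} k rj²` (next level's family size);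
`Ψ'` = the map built from the deeper blocks and `Φ`, not touching `emb`; the characteristic clause
`char = 0 ∨ ((s+1)^d)^{rj} < char` (degree bound `(s+1)^d` of the members, Jacobian criterion);
`IH` = `Ψ'` is faithful (Thm. 2.1 form) to every family of `≤ rj1` derivatives of order `≤ c+1` of
occur-`k` size-`≤ s` formulas of depth `≤ d-1`; Lemma 4.2 on the formula model is val-lit t19's
`ASSS16.descentJacobian`. Conclusion: `x_m ↦ block(m) + Ψ'(x_m)` is faithful to every family
`U` of `≤ rj` derivatives of order `≤ c` of occur-`k` size-`≤ s` formulas of depth `≤ d`. Proof as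
printed: a transcendence basis `U'` of `U` has a non-zero `|U'|×|U'|` Jacobian minor
(`exists_trdeg_jacobianMinor_ne_zero`); it factors as `∏ V_G^{e_G} · V` with `V` a polynomial in the
next level's family `Elem(V)` (Lemma 4.2); `IH` keeps `V` and the `V_G` (as singleton families)
non-zero under `Ψ'`; Cor. 4.3 (`descentFaithful` = Lemma 2.2) lifts.
[cite: AgrawalEtAl2011, §4 (Lemma 4.2, Cor. 4.3, proof of Thm. dDkrPIT)]
locator: paper:arxiv-1111.0582 p0010.txt:L1–L46 -/
theorem thm48_levelInvariant_step (k s d c rj rj1 : ℕ) (hd : 3 ≤ d) (hk : 1 ≤ k)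
    (hcount : (c + 1) * 2 ^ (c + 1) * k * rj ^ 2 ≤ rj1)
    (Ψ' : MvPolynomial (multilinearMonomials n) F →ₐ[F] MvPolynomial σ F)
    (emb : Fin rj ⊕ Unit → σ) (hemb : Function.Injective emb)
    (hfresh : ∀ mm : multilinearMonomials n, ∀ v ∈ (Ψ' (X mm)).vars, v ∉ Set.range emb)
    (hchar : ringChar F = 0 ∨ ((s + 1) ^ d) ^ rj < ringChar F)
    (IH : ∀ (m' : ℕ) (H : Fin m' → OccurFormula F (multilinearMonomials n))
        (T' : Fin m' → multilinearMonomials n →₀ ℕ), m' ≤ rj1 →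
        (∀ u i, (H u).occur i ≤ k) → (∀ u, (H u).size ≤ s) → (∀ u, (H u).depth ≤ d - 1) →
        (∀ u, (T' u).degree ≤ c + 1) → ∀ Q : MvPolynomial (Fin m') F,
        aeval (fun u => iterPderiv (A := F) (T' u) (H u).eval) Q ≠ 0 ↔
          aeval (fun u => Ψ' (iterPderiv (A := F) (T' u) (H u).eval)) Q ≠ 0)
    (m : ℕ) (G : Fin m → OccurFormula F (multilinearMonomials n))
    (T : Fin m → multilinearMonomials n →₀ ℕ) (hm : m ≤ rj)
    (hocc : ∀ u i, (G u).occur i ≤ k) (hsize : ∀ u, (G u).size ≤ s)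
    (hdepth : ∀ u, (G u).depth ≤ d) (hT : ∀ u, (T u).degree ≤ c)
    (C : MvPolynomial (Fin m) F) :
    aeval (fun u => iterPderiv (A := F) (T u) (G u).eval) C ≠ 0 ↔
      aeval (fun u => aeval (fun mm : multilinearMonomials n =>
          rename emb (vdmGenCoeff F n rj (mm : Fin n →₀ ℕ)) + Ψ' (X mm))
        (iterPderiv (A := F) (T u) (G u).eval)) C ≠ 0 := by
  classical
  haveI : Fintype (multilinearMonomials n) := Fintype.ofEquiv (Fin (2 ^ n)) (binaryOrder n)
  -- the family and its bounds
  have hdegU : ∀ u, ((fun u => iterPderiv (A := F) (T u) (G u).eval) u).totalDegree ≤ (s + 1) ^ d :=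
    fun u => OccurFormula.totalDegree_iterPderiv_eval_le (G u) (hsize u) (hdepth u) (T u)
  have htr : TrdegLE F (fun u => iterPderiv (A := F) (T u) (G u).eval) rj :=
    ASSS16.trdegLE_fin_of_le _ hm
  -- Fact 1: a transcendence basis with a non-zero Jacobian minor
  obtain ⟨ρ, hρr, hρ, rows, cols, -, -, hdet⟩ :=
    ASSS16.exists_trdeg_jacobianMinor_ne_zero _ hdegU htr hchar
  -- Cor. 4.3 (Lemma 2.2): it suffices that `Ψ'` keeps the minor non-zero
  refine ASSS16.descentFaithful _ hdegU htr hchar Ψ' emb hemb hfresh hρ rows cols ?_ C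
  rcases Nat.eq_zero_or_pos ρ with hρ0 | hρpos
  · subst hρ0
    rw [Matrix.det_isEmpty, map_one]
    exact one_ne_zero
  -- Lemma 4.2: the minor factors through the next level
  obtain ⟨mV, K, eV, m', H, T', V, hfac, hVmem, hm', -, hK, hH⟩ :=
    ASSS16.descentJacobian G T hocc hsize hdepth hT rows cols
  have hdet' : (Matrix.of fun u v => pderiv (cols v)
      ((fun u => iterPderiv (A := F) (T u) (G u).eval) (rows u))).det =
      (∏ j, (K j).eval ^ eV j) * V := hfac
  have hne : (∏ j, (K j).eval ^ eV j) * V ≠ 0 := hdet' ▸ hdet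
  have hV0 : V ≠ 0 := right_ne_zero_of_mul hne
  have hP0 : (∏ j, (K j).eval ^ eV j) ≠ 0 := left_ne_zero_of_mul hne
  -- sizes: `m' ≤ rj1`, `1 ≤ rj1`
  have hm'le : m' ≤ rj1 := (hm'.trans (level_count_le_asssStep hρr)).trans hcount
  have hrj : 1 ≤ rj := (show 1 ≤ ρ from hρpos).trans hρr
  have hrj1 : 1 ≤ rj1 := by
    have : 0 < (c + 1) * 2 ^ (c + 1) * k * rj ^ 2 := by positivity
    omega
  rw [hdet', map_mul]
  refine mul_ne_zero ?_ ?_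
  · -- the factors `V_G^{e_G}`: singleton families one level down
    rw [map_prod]
    refine Finset.prod_ne_zero_iff.2 fun j _ => ?_
    rw [map_pow]
    rcases Nat.eq_zero_or_pos (eV j) with h0 | hpos
    · rw [h0, pow_zero]; exact one_ne_zero
    refine pow_ne_zero _ ?_
    have hKj0 : (K j).eval ≠ 0 := by
      intro h0
      exact hP0 (Finset.prod_eq_zero (Finset.mem_univ j) (by rw [h0, zero_pow hpos.ne']))
    have h1 := IH 1 (fun _ => K j) (fun _ => 0) hrj1 (fun _ i => (hK j).1 i) (fun _ => (hK j).2.1)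
      (fun _ => by have := (hK j).2.2; omega) (fun _ => by simp) (X 0)
    have e0 : iterPderiv (A := F) (0 : multilinearMonomials n →₀ ℕ) (K j).eval = (K j).eval := by
      rw [iterPderiv_zero]; rfl
    simp only [aeval_X, e0] at h1
    exact h1.1 hKj0
  · -- the factor `V ∈ 𝔽[Elem(V)]`: the next level's family
    rw [Algebra.adjoin_range_eq_range_aeval] at hVmem
    obtain ⟨Q, hQ⟩ := (AlgHom.mem_range _).1 hVmem
    rw [← hQ] at hV0 ⊢
    have h2 := IH m' H T' hm'le (fun u i => (hH u).1 i) (fun u => (hH u).2.1)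
      (fun u => by have := (hH u).2.2.1; omega) (fun u => (hH u).2.2.2)
    exact ASSS16.map_aeval_ne_zero_of_faithful Ψ' _ (fun Q' hQ' => (h2 Q').1 hQ') Q hV0

end Step

/-! ## Part C. The level induction and the assembly of `FSV2018_thm48_topFanIn` (Lemma 4.2 on the
formula model = val-lit t19's `ASSS16.descentJacobian`; the bottom level = val-lit t21's
`ASSS16.baseLevel`; the layout step = val-lit p2's `ASSS16.descentFaithful`) -/

section Keystone

/-- **[ASSS16] §4, Thm. dDkrPIT in FSV's generator form — the level recursion, with the
characteristic clause as the proof needs it.** With `R = asssRTop k D t = (2·max(k,t))^{2D·2^D}` and the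
block sizes `r_ℓ := (asssRec k t ℓ).1 ≤ R` (val-lit t21's `asssRec_fst_le_asssR_max_of_le_sub_three`),
the map `Ψ_j : x_m ↦ Σ_{ℓ ≥ j} Vdm_{r_ℓ}(y_ℓ, t_ℓ)_m + Φ(w)_m` (blocks `j, …, D-3` and `Φ`) is
faithful (Thm. 2.1 form) to every family of `≤ r_j` derivatives of order `≤ j` of occur-`k`
size-`≤ s` sub-formulas of depth `≤ D-1-j` ("`Ψ_ℓ` is faithful to `𝒞_ℓ`", levels `ℓ = j+2`), by
downward induction from the leaf level `j = D-3` (`ASSS16.baseLevel`: sparse Jacobian minors are hit by `Φ`)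
via `thm48_levelInvariant_step`; at `j = 0` the family of children of the root `+` gate gives the generator
statement ("`Ψ` faithful to `T = {T_1, …, T_k}` ⟹ `Ψ(C) ≠ 0`", Thm. 2.1). Characteristic clause AS
THE PROOF NEEDS IT (level-wise Jacobian criterion): `char = 0 ∨ ∀ j ≤ D-3, ((s+1)^{D-1-j})^{r_j} < char`.
[cite: AgrawalEtAl2011, §4 (Thm. dDkrPIT with Lemma 4.2, Cor. 4.3); ForbesShpilkaVolk2018, Thm. 48 (seq.) = ToC Thm. 5.24]
locator: paper:arxiv-1111.0582 p0009.txt:L24–L34, p0010.txt:L1–L62 -/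
theorem FSV2018_thm48_topFanIn_of_clause (F : Type) [Field F] (n D k s t : ℕ) (τ : Type)
    (Φ : multilinearMonomials n → MvPolynomial τ F)
    (hclause : ringChar F = 0 ∨
      ∀ j, j + 3 ≤ D → ((s + 1) ^ (D - 1 - j)) ^ (asssRec k t j).1 < ringChar F)
    (hΦ : IsHittingSetGenerator
      {P : MvPolynomial (multilinearMonomials n) F |
        P.support.card ≤ (asssRTop k D t).factorial * s ^ asssRTop k D t} Φ) :
    ∃ r : Fin (D - 2) → Fin (asssRTop k D t + 1),
      IsHittingSetGenerator (occurClassTopFanIn F (multilinearMonomials n) D k s t)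
        (fun m : multilinearMonomials n =>
          (∑ ℓ : Fin (D - 2),
            rename (fun v : Fin (r ℓ) ⊕ Unit =>
                (Sum.inl (ℓ, Sum.map (Fin.castLE (Nat.lt_succ_iff.mp (r ℓ).isLt)) id v) :
                  (Fin (D - 2) × (Fin (asssRTop k D t) ⊕ Unit)) ⊕ τ))
              (vdmGenCoeff F n (r ℓ) (m : Fin n →₀ ℕ))) +
            rename Sum.inr (Φ m)) := by
  classical
  haveI : Fintype (multilinearMonomials n) := Fintype.ofEquiv (Fin (2 ^ n)) (binaryOrder n)
  -- block sizes `r_ℓ := (asssRec k t ℓ).1 ≤ R`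
  have hrB : ∀ ℓ : Fin (D - 2), (asssRec k t ℓ).1 ≤ asssRTop k D t := fun ℓ =>
    ASSS16.asssRec_fst_le_asssR_max_of_le_sub_three (k := k) (t := t) (D := D)
      (by have := ℓ.2; omega) (by have := ℓ.2; omega)
  let r : Fin (D - 2) → Fin (asssRTop k D t + 1) :=
    fun ℓ => ⟨(asssRec k t ℓ).1, Nat.lt_succ_of_le (hrB ℓ)⟩
  refine ⟨r, ?_⟩
  -- the seed slots of block `ℓ`, the blocks, the stage maps `Ψ_j` (blocks `≥ j` and `Φ`)
  set slot : (ℓ : Fin (D - 2)) → Fin (r ℓ) ⊕ Unit →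
      (Fin (D - 2) × (Fin (asssRTop k D t) ⊕ Unit)) ⊕ τ :=
    fun ℓ v => Sum.inl (ℓ, Sum.map (Fin.castLE (Nat.lt_succ_iff.mp (r ℓ).isLt)) id v) with hslot
  set block : Fin (D - 2) → multilinearMonomials n →
      MvPolynomial ((Fin (D - 2) × (Fin (asssRTop k D t) ⊕ Unit)) ⊕ τ) F :=
    fun ℓ mm => rename (slot ℓ) (vdmGenCoeff F n (r ℓ) (mm : Fin n →₀ ℕ)) with hblock
  set stageGen : ℕ → multilinearMonomials n →
      MvPolynomial ((Fin (D - 2) × (Fin (asssRTop k D t) ⊕ Unit)) ⊕ τ) F :=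
    fun j mm => (∑ ℓ ∈ (Finset.univ : Finset (Fin (D - 2))).filter (fun ℓ : Fin (D - 2) => j ≤ ℓ.val),
      block ℓ mm) + rename Sum.inr (Φ mm) with hstageGen
  set Ψ : ℕ → (MvPolynomial (multilinearMonomials n) F →ₐ[F]
      MvPolynomial ((Fin (D - 2) × (Fin (asssRTop k D t) ⊕ Unit)) ⊕ τ) F) :=
    fun j => aeval (stageGen j) with hΨ
  -- the slots are injective and pairwise apart; the stage maps split off one block at a time
  have hslotinj : ∀ ℓ, Function.Injective (slot ℓ) := by
    intro ℓ v w h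
    rw [hslot] at h
    simp only [Sum.inl.injEq, Prod.mk.injEq, true_and] at h
    exact (Sum.map_injective.2 ⟨Fin.castLE_injective _, Function.injective_id⟩) h
  have hslotinr : ∀ ℓ v (w : τ), slot ℓ v ≠ Sum.inr w := by
    intro ℓ v w h
    rw [hslot] at h
    exact Sum.inl_ne_inr h
  have hsplit : ∀ (j : ℕ) (hj : j < D - 2) (mm : multilinearMonomials n),
      stageGen j mm = block ⟨j, hj⟩ mm + stageGen (j + 1) mm := by
    intro j hj mm
    have hfilter : (Finset.univ.filter fun ℓ : Fin (D - 2) => j ≤ ℓ.val) =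
        insert ⟨j, hj⟩ (Finset.univ.filter fun ℓ : Fin (D - 2) => j + 1 ≤ ℓ.val) := by
      ext ℓ
      simp only [Finset.mem_filter, Finset.mem_univ, true_and, Finset.mem_insert, Fin.ext_iff]
      omega
    have hnot : (⟨j, hj⟩ : Fin (D - 2)) ∉
        (Finset.univ.filter fun ℓ : Fin (D - 2) => j + 1 ≤ ℓ.val) := by simp
    rw [hstageGen]
    simp only
    rw [hfilter, Finset.sum_insert hnot, add_assoc]
  have hΨsplit : ∀ (j : ℕ) (hj : j < D - 2), Ψ j = aeval (fun mm : multilinearMonomials n =>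
      rename (slot ⟨j, hj⟩) (vdmGenCoeff F n (r ⟨j, hj⟩) (mm : Fin n →₀ ℕ)) + Ψ (j + 1) (X mm)) := by
    intro j hj
    refine MvPolynomial.algHom_ext fun mm => ?_
    rw [hΨ]
    simp only [aeval_X]
    rw [hsplit j hj mm, hblock]
  have hlast : ∀ mm : multilinearMonomials n, Ψ (D - 2) (X mm) = rename Sum.inr (Φ mm) := by
    intro mm
    rw [hΨ]
    simp only [aeval_X]
    rw [hstageGen]
    simp only
    rw [Finset.filter_false_of_mem, Finset.sum_empty, zero_add]
    intro ℓ _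
    exact not_le.2 ℓ.2
  -- block `j` is fresh for `Ψ_{j+1}`
  have hfresh : ∀ (j : ℕ) (hj : j < D - 2) (mm : multilinearMonomials n),
      ∀ v ∈ (Ψ (j + 1) (X mm)).vars, v ∉ Set.range (slot ⟨j, hj⟩) := by
    intro j hj mm v hv
    rintro ⟨w, rfl⟩
    rw [hΨ] at hv
    simp only [aeval_X] at hv
    rw [hstageGen] at hv
    simp only at hv
    rcases Finset.mem_union.1 (vars_add_subset _ _ hv) with h | h
    · obtain ⟨ℓ, hℓ, hvℓ⟩ := Finset.mem_biUnion.1 (vars_sum_subset _ _ h)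
      rw [hblock] at hvℓ
      obtain ⟨w', -, hw'⟩ := Finset.mem_image.1 (vars_rename _ _ hvℓ)
      have hjℓ : j + 1 ≤ (ℓ : ℕ) := (Finset.mem_filter.1 hℓ).2
      rw [hslot] at hw'
      simp only [Sum.inl.injEq, Prod.mk.injEq] at hw'
      have := congrArg Fin.val hw'.1
      simp only at this
      omega
    · obtain ⟨w', -, hw'⟩ := Finset.mem_image.1 (vars_rename _ _ h)
      exact hslotinr _ _ _ hw'.symm
  -- the level-wise characteristic clause
  have hclause' : ∀ j, j + 3 ≤ D →
      (ringChar F = 0 ∨ ((s + 1) ^ (D - 1 - j)) ^ (asssRec k t j).1 < ringChar F) :=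
    fun j hj => hclause.imp id fun h => h j hj
  -- THE GENERATOR STATEMENT
  intro P hP hP0
  obtain ⟨as, hPeval, hdepthC, hoccC, hsizeC, hlen⟩ := hP
  obtain ⟨m, G, hmlen, hev, hoccsum, hsz, hdp⟩ := OccurArgs.exists_fin_view_length as
  -- degenerate cases: `D ≤ 2` (the root's children are empty gates) and `k = 0` (no variable
  -- occurs): `P` is a non-zero constant
  have hconst : ∀ c : F, P = C c → (bind₁ (fun m : multilinearMonomials n =>
      (∑ ℓ : Fin (D - 2), rename (fun v : Fin (r ℓ) ⊕ Unit =>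
          (Sum.inl (ℓ, Sum.map (Fin.castLE (Nat.lt_succ_iff.mp (r ℓ).isLt)) id v) :
            (Fin (D - 2) × (Fin (asssRTop k D t) ⊕ Unit)) ⊕ τ))
        (vdmGenCoeff F n (r ℓ) (m : Fin n →₀ ℕ))) + rename Sum.inr (Φ m)) P ≠ 0) := by
    rintro c rfl
    rw [bind₁_C_right, Ne, C_eq_zero]
    rwa [Ne, C_eq_zero] at hP0
  rcases lt_or_ge D 3 with hD3 | hD3
  · have h1 := hdepthC
    rw [OccurFormula.depth] at h1
    obtain ⟨c, hc⟩ := OccurArgs.exists_evalSum_eq_C_of_depth_le_one as (by omega)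
    exact hconst c (by rw [← hPeval, OccurFormula.eval, hc])
  rcases Nat.eq_zero_or_pos k with hk0 | hk1
  · subst hk0
    obtain ⟨c, hc⟩ := OccurFormula.exists_eval_eq_C_of_occur_eq_zero (OccurFormula.add as)
      fun i => Nat.le_zero.1 (hoccC i)
    exact hconst c (by rw [← hPeval, hc])
  have hs1 : 1 ≤ s := by
    have h1 := hsizeC
    rw [OccurFormula.size] at h1
    omega
  have hD1 : 1 ≤ D := by omega
  -- THE LEVEL INDUCTION: `key i j _` = INV(j) for `i + j + 3 = D`
  have key : ∀ i j : ℕ, i + j + 3 = D →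
      ∀ (m : ℕ) (G : Fin m → OccurFormula F (multilinearMonomials n))
        (T : Fin m → multilinearMonomials n →₀ ℕ),
        m ≤ (asssRec k t j).1 → (∀ u i', (G u).occur i' ≤ k) → (∀ u, (G u).size ≤ s) →
        (∀ u, (G u).depth ≤ D - 1 - j) → (∀ u, (T u).degree ≤ j) →
        ∀ C : MvPolynomial (Fin m) F,
          aeval (fun u => iterPderiv (A := F) (T u) (G u).eval) C ≠ 0 ↔
            aeval (fun u => Ψ j (iterPderiv (A := F) (T u) (G u).eval)) C ≠ 0 := by
    intro i
    induction i with
    | zero =>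
      intro j hj m G T hm hocc hsize hdepth hT C
      have hj' : j < D - 2 := by omega
      have hj1 : j + 1 = D - 2 := by omega
      have h2 : D - 1 - j = 2 := by omega
      rw [hΨsplit j hj']
      have hmap : (fun mm : multilinearMonomials n =>
          rename (slot ⟨j, hj'⟩) (vdmGenCoeff F n (r ⟨j, hj'⟩) (mm : Fin n →₀ ℕ)) +
            Ψ (j + 1) (X mm)) =
          fun mm : multilinearMonomials n =>
            rename (slot ⟨j, hj'⟩) (vdmGenCoeff F n (r ⟨j, hj'⟩) (mm : Fin n →₀ ℕ)) +
              rename Sum.inr (Φ mm) := by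
        funext mm
        rw [hj1, hlast]
      rw [hmap]
      have hchar := hclause' j (by omega)
      rw [h2] at hchar
      refine ASSS16.baseLevel (fun u => (G u).eval) T hs1
        (fun u => OccurFormula.card_support_eval_le_of_depth_le_two hs1 (G u)
          (by rw [← h2]; exact hdepth u) (hsize u))
        (fun u => OccurFormula.totalDegree_iterPderiv_eval_le (G u) (hsize u)
          (by rw [← h2]; exact hdepth u) (T u))
        hm hchar (ASSS16.sparsity_budget_of_le_sub_three hs1 hD1 (by omega)) Φ hΦ
        Sum.inr Sum.inr_injective (slot ⟨j, hj'⟩) (hslotinj ⟨j, hj'⟩) (hslotinr ⟨j, hj'⟩) C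
    | succ i ih =>
      intro j hj m G T hm hocc hsize hdepth hT C
      have hj' : j < D - 2 := by omega
      rw [hΨsplit j hj']
      refine thm48_levelInvariant_step k s (D - 1 - j) j (asssRec k t j).1 (asssRec k t (j + 1)).1 (by omega) hk1
        (le_of_eq (ASSS16.asssRec_fst_succ k t j).symm) (Ψ (j + 1)) (slot ⟨j, hj'⟩) (hslotinj _)
        (hfresh j hj') (hclause' j (by omega)) ?_ m G T hm hocc hsize hdepth hT C
      intro m' H T' hm' hoccH hsizeH hdepthH hT' Q
      exact ih (j + 1) (by omega) m' H T' hm' hoccH hsizeH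
        (fun u => by have := hdepthH u; omega) hT' Q
  -- THE TOP LEVEL: the children of the root `+` gate
  have hm : m ≤ (asssRec k t 0).1 := by
    show m ≤ t
    omega
  have hoccG : ∀ u i, (G u).occur i ≤ k := fun u i => by
    have h1 := hoccC i
    rw [OccurFormula.occur, hoccsum] at h1
    have h2 : (G u).occur i ≤ ∑ v, (G v).occur i :=
      Finset.single_le_sum (f := fun v => (G v).occur i) (fun _ _ => Nat.zero_le _) (Finset.mem_univ u)
    omega
  have hsizeG : ∀ u, (G u).size ≤ s := fun u => by
    have h1 := hsizeC
    rw [OccurFormula.size, hsz] at h1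
    have h2 : (G u).size ≤ ∑ i, (G i).size :=
      Finset.single_le_sum (f := fun i => (G i).size) (fun _ _ => Nat.zero_le _) (Finset.mem_univ u)
    omega
  have hdepthG : ∀ u, (G u).depth ≤ D - 1 - 0 := fun u => by
    have h1 := hdepthC
    rw [OccurFormula.depth] at h1
    have := hdp u
    omega
  have hfaith := key (D - 3) 0 (by omega) m G (fun _ => 0) hm hoccG hsizeG hdepthG
    (fun _ => by simp)
  have e0 : ∀ u, iterPderiv (A := F) (0 : multilinearMonomials n →₀ ℕ) (G u).eval = (G u).eval :=
    fun u => by rw [iterPderiv_zero]; rfl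
  simp only [e0] at hfaith
  have hPsum : P = aeval (fun u => (G u).eval) (∑ u : Fin m, (X u : MvPolynomial (Fin m) F)) := by
    rw [← hPeval, OccurFormula.eval, hev, map_sum]
    simp only [aeval_X]
  have h0 : (Finset.univ.filter fun ℓ : Fin (D - 2) => 0 ≤ ℓ.val) = Finset.univ :=
    Finset.filter_true_of_mem fun _ _ => Nat.zero_le _
  have hgen : (fun m : multilinearMonomials n =>
      (∑ ℓ : Fin (D - 2), rename (fun v : Fin (r ℓ) ⊕ Unit =>
          (Sum.inl (ℓ, Sum.map (Fin.castLE (Nat.lt_succ_iff.mp (r ℓ).isLt)) id v) :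
            (Fin (D - 2) × (Fin (asssRTop k D t) ⊕ Unit)) ⊕ τ))
        (vdmGenCoeff F n (r ℓ) (m : Fin n →₀ ℕ))) + rename Sum.inr (Φ m)) = stageGen 0 := by
    funext mm
    simp only [hstageGen, hblock, hslot, h0]
  rw [hgen]
  show Ψ 0 P ≠ 0
  rw [hPsum]
  exact ASSS16.map_aeval_ne_zero_of_faithful (Ψ 0) (fun u => (G u).eval)
    (fun Q hQ => (hfaith Q).1 hQ) _ (hPsum ▸ hP0)

/-! ## Part D. The printed characteristic clause, and the discharge -/

/-- **The clause of the printed statement implies the clause the proof needs** (`s ≥ 2`): from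
`char = 0 ∨ s^R < char`, `R = asssRTop k D t = (2·max(k,t))^{2D·2^D}`, the level-wise Jacobian
requirements `((s+1)^{D-1-j})^{r_j} < char` (val-lit t21's `char_clause_of_level_sub_three`:
`(s+1)^{D·r_j} ≤ s^R`). [cite: AgrawalEtAl2011, §4 (Thm. dDkrPIT: "For the Jacobian criterion to work we need char(𝔽) = 0 or > s^R")]
locator: paper:arxiv-1111.0582 p0010.txt:L60–L62 -/
theorem thm48_clause_of_printed_clause {F : Type*} [Field F] {D k s t : ℕ} (hs : 2 ≤ s)
    (hchar : ringChar F = 0 ∨ s ^ asssRTop k D t < ringChar F) :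
    ringChar F = 0 ∨
      ∀ j, j + 3 ≤ D → ((s + 1) ^ (D - 1 - j)) ^ (asssRec k t j).1 < ringChar F := by
  rcases hchar with h0 | hlt
  · exact Or.inl h0
  · refine Or.inr fun j hj => ?_
    have h := ASSS16.char_clause_of_level_sub_three (F := F) (k := k) (t := t)
      (d := (s + 1) ^ (D - 1 - j)) (r := (asssRec k t j).1) hs (by omega) (by omega)
      (Nat.pow_le_pow_right (Nat.succ_pos s) (by omega)) le_rfl (Or.inr hlt)
    rcases h with h0 | h
    · rw [h0] at hlt
      exact absurd hlt (Nat.not_lt_zero _)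
    · exact h

/-- **`FSV2018_thm48_topFanIn` — the named fact DISCHARGED** ([ASSS16] §4, Thm. dDkrPIT in FSV's
generator form, `R = (2·max(k,t))^{2D·2^D}`): the printed clause `char = 0 ∨ s^R < char` is
converted by `thm48_clause_of_printed_clause` for `s ≥ 2`; for `s ≤ 1` every formula of the class is a
constant (val-lit p1's `isHittingSetGenerator_occurClass_of_le_one`).
[cite: AgrawalEtAl2011, §4 (Thm. dDkrPIT); ForbesShpilkaVolk2018, Thm. 48 (seq.) = ToC Thm. 5.24] -/
theorem FSV2018_thm48_topFanIn_holds : FSV2018_thm48_topFanIn := by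
  intro F _ n D k s t τ Φ hchar hΦ
  rcases Nat.lt_or_ge s 2 with hs | hs
  · refine ⟨fun _ => ⟨0, Nat.succ_pos _⟩, ?_⟩
    exact (isHittingSetGenerator_occurClass_of_le_one _ (by omega)).anti
      (occurClassTopFanIn_subset_occurClass _ D k s t)
  · exact FSV2018_thm48_topFanIn_of_clause F n D k s t τ Φ (thm48_clause_of_printed_clause hs hchar) hΦ

end Keystone

end Literature.Computability.AlgebraicComplexity
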